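import Summits.CriticalPhenomena.PercolationContinuityZ3.Theorems.PercFiniteBoxLRORenormaliseFromLinearLRODenseCriterion
import Summits.CriticalPhenomena.PercolationContinuityZ3.Theorems.PercFiniteBoxLRORenormaliseFromLinearLROSpineDefs
import Summits.CriticalPhenomena.PercolationContinuityZ3.Theorems.PercFiniteBoxLRORenormaliseFromLinearLROStubSpineGlue
import Summits.CriticalPhenomena.PercolationContinuityZ3.Theorems.PercFiniteBoxLRORenormaliseFromLinearLROStubSpineFailure

/-!
# Crux `PercFiniteBoxLRO.RenormaliseFromLinearLRO` (stmt-CriticalPhenomena-0857), line `registered`, reshape 3 —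
# the SPINE criterion (one threshold for every LRO ratio), no spines at `p_c`, the near-maximal regime with a `1/K`
# window, and the composition from the weakened open statement

Assembled, unconditional output of reshape 3 (lead c1, 2026-08-17) over the landed `stub_spineLocal` (p162413),
`stub_spineGlue` (p162811), `stub_spineFailure` (p163025) and reshape 2 (`…DenseCriterion.lean`, p161630):

* `spineCriterion` — ONE `δ₀ > 0` such that for all `2 ≤ K ≤ L`, `p`, `s`, `m ≥ 1`:
  `P_p(spineBox K s m L) > 1 − δ₀ ⇒ θ_{ℤ³}(p) > 0` (the spine field at spacing `L·n` is `5`-dependent whatever `K` is).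
* `real_spineBox_criticalProbI_le` (registered sub-goal `stub_noSpineAtPc`) — no spines at `p_c`, unconditionally.
* `not_nearMaximal_linearLRO_criticalProbI'` (registered sub-goal `stub_noNearMaximalLRO_inv`) — **an ABSOLUTE `c₀ > 0`
  such that for every `K ≥ 2` linear-scale finite-box LRO at `p_c(ℤ³)` with constants `(ρ, K)` is impossible once
  `ρ ≥ (1 − c₀/K)·θ(p_c)²`** (reshape 2 had `η₀(K)` of Peierls size in `K`; the spine's union bound costs only `4K+2`).
* `critSpine_of_critDense` — the new open statement is implied by the old one; `not_linearLRO_criticalProbI_of_critSpine`,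
  `renormaliseFromLinearLRO_of_critSpine` — the crux BY NAME from the weakened open statement `stub_critSpine`
  (`LRO_lin(p_c)`, `K ≥ 2` ⇒ for every `δ > 0` a spine block of probability `> 1 − δ`).

Lands `--supports stmt-CriticalPhenomena-0857`.
-/

noncomputable section

namespace Summit.CriticalPhenomena.PercolationContinuityZ3.Theorems.RenormaliseFromLinearLRO

open Literature.Probability.Percolation Literature.Probability.LatticeModels
open MeasureTheory Filter Topology

/-- `q ↦ P_q(spineBox K s m L)` is continuous on `[0,1]` (a polynomial; from Stub S1). -/
theorem continuous_real_spineBox {K s m L : ℕ} (hK : 2 ≤ K) (hm : 1 ≤ m) (hKL : K ≤ L) :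
    Continuous fun q : unitInterval => (bondPercolation (zdGraph 3) q).real (spineBox K s m L) :=
  continuous_bondPercolation_real_of_isLocalEvent (zdGraph 3) ⟨_, stub_spineLocal K s m L hK hm hKL⟩

/-- **The same-`p` SPINE criterion, with ONE threshold for all ratios**: there is `δ₀ > 0` such that for all
`2 ≤ K ≤ L`, all `p`, `s`, `m ≥ 1`: `P_p(spineBox K s m L) > 1 − δ₀ ⇒ θ_{ℤ³}(p) > 0`.  Proof: `δ₀ := η(5)/2` from DST
dependent percolation; the spine field at spacing `L·n` is `5`-dependent (Stub S1: radius `2Ln`, `4Ln < 5Ln`, generic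
Stub I) with densities `≥ 2P(spine) − 1 > 1 − η`, hence percolates; pull back and glue (Stub S2); union bound over
`Λ(Kn)`, `θ_x = θ_0`. -/
theorem spineCriterion :
    ∃ δ₀ : ℝ, 0 < δ₀ ∧ ∀ (K L : ℕ), 2 ≤ K → K ≤ L → ∀ (p : unitInterval) (s m : ℕ), 1 ≤ m →
      1 - δ₀ < (bondPercolation (zdGraph 3) p).real (spineBox K s m L) → 0 < theta (zdGraph 3) 0 p := by
  obtain ⟨η, hη, hD⟩ := DuminilCopinSidoraviciusTassion2016_dependentPercolation_holds 5
  refine ⟨η / 2, half_pos hη, ?_⟩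
  intro K L hK hKL p s m hm hgood
  set N : ℕ := (2 * s + 1) * m with hN
  have hN1 : 1 ≤ N := by rw [hN]; exact Nat.mul_pos (Nat.succ_pos _) hm
  have hL1 : 1 ≤ L := le_trans (by omega) hKL
  set n : ℕ := L * N with hn
  have hE : MeasurableSet (spineBox K s m L) := measurableSet_spineBox hK hm L
  haveI := isProbabilityMeasure_blockLaw n hE p
  -- (1) the spine field is 5-dependent with densities ≥ 1 - η: it percolates
  have hdep := stub_blockLawInputs.1 p n (2 * L * N) 5 (spineBox K s m L)
    (by rw [hn]; nlinarith) hE (stub_spineLocal K s m L hK hm hKL)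
  have hdens : ∀ e ∈ (zdGraph 2).edgeSet, 1 - η ≤ (blockLaw n (spineBox K s m L) p).real {σ | e ∈ σ} := by
    intro e he
    have h := stub_blockLawInputs.2 p n (spineBox K s m L) hE e he
    linarith
  have hperc : 0 < (blockLaw n (spineBox K s m L) p).real (percolatesAt (0 : Site 2)) :=
    hD (blockLaw n (spineBox K s m L) p) (fun F₁ F₂ hfar A B hA hB hAm hBm =>
      hdep F₁ F₂ (by exact_mod_cast hfar) A B hA hB hAm hBm) hdens
  -- (2) pull back to ℤ³ and glue (Stub S2)
  simp only [blockLaw] at hperc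
  rw [map_measureReal_apply (measurable_blockCfg n hE) (measurableSet_percolatesAt_holds (0 : Site 2))]
    at hperc
  have hle : (bondPercolation (zdGraph 3) p).real (blockCfg n (spineBox K s m L) ⁻¹' percolatesAt (0 : Site 2))
      ≤ (bondPercolation (zdGraph 3) p).real (⋃ x ∈ box 3 (K * N), percolatesAt x) := by
    refine measureReal_mono (fun ω hω => ?_) (measure_ne_top _ _)
    obtain ⟨x, hx, hinf⟩ := stub_spineGlue K s m L hm hL1 ω hω
    exact Set.mem_iUnion₂.2 ⟨x, hx, hinf⟩
  have hpos : 0 < (bondPercolation (zdGraph 3) p).real (⋃ x ∈ box 3 (K * N), percolatesAt x) :=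
    hperc.trans_le hle
  -- (3) union bound and θ_x = θ_0
  have hub : (bondPercolation (zdGraph 3) p).real (⋃ x ∈ box 3 (K * N), percolatesAt x) ≤
      ∑ x ∈ box 3 (K * N), (bondPercolation (zdGraph 3) p).real (percolatesAt x) :=
    measureReal_biUnion_finset_le _ _
  have hsum : ∑ x ∈ box 3 (K * N), (bondPercolation (zdGraph 3) p).real (percolatesAt x) =
      ((box 3 (K * N)).card : ℝ) * theta (zdGraph 3) 0 p := by
    have hx : ∀ x ∈ box 3 (K * N),
        (bondPercolation (zdGraph 3) p).real (percolatesAt x) = theta (zdGraph 3) 0 p :=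
      fun x _ => theta_zdGraph_eq_theta_zero p x
    rw [Finset.sum_congr rfl hx, Finset.sum_const, nsmul_eq_mul]
  by_contra hθ
  have hθ0 : theta (zdGraph 3) 0 p = 0 := le_antisymm (not_lt.1 hθ) measureReal_nonneg
  rw [hθ0, mul_zero] at hsum
  linarith

/-- **No spines at criticality** (unconditional output of the spine criterion at `p_c`): with its `δ₀`,
`P_{p_c}(spineBox K s m L) ≤ 1 − δ₀` for all `2 ≤ K ≤ L`, `s`, `m ≥ 1`. -/
theorem real_spineBox_criticalProbI_le :
    ∃ δ₀ : ℝ, 0 < δ₀ ∧ ∀ (K L : ℕ), 2 ≤ K → K ≤ L → ∀ s m : ℕ, 1 ≤ m →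
      (bondPercolation (zdGraph 3) (criticalProbI 3)).real (spineBox K s m L) ≤ 1 - δ₀ := by
  obtain ⟨δ₀, hδ, hcrit⟩ := spineCriterion
  refine ⟨δ₀, hδ, fun K L hK hKL s m hm => ?_⟩
  by_contra hgt
  have hgood : 1 - δ₀ < (bondPercolation (zdGraph 3) (criticalProbI 3)).real (spineBox K s m L) := not_le.1 hgt
  have h0lt : (0 : unitInterval) < criticalProbI 3 := by
    show (0 : ℝ) < criticalProb (zdGraph 3) (0 : Site 3)
    exact criticalProb_zd_pos 3 (by norm_num)
  obtain ⟨q, hqp, hq⟩ :=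
    exists_lt_of_continuous_unitInterval (continuous_real_spineBox hK hm hKL) h0lt hgood
  have hθq : 0 < theta (zdGraph 3) 0 q := hcrit K L hK hKL q s m hm hq
  have hq0 : theta (zdGraph 3) (0 : Site 3) q = 0 :=
    theta_eq_zero_of_lt_criticalProb_holds (zdGraph 3) (0 : Site 3) q hqp
  exact absurd hq0 (ne_of_gt hθq)

/-- **`¬LRO_lin(p_c)` from the open spine stub**: `K = 0` vacuous, `K = 1` Barsky–Grimmett–Newman, `K ≥ 2`: Stub D'
with `δ := δ₀` contradicts `real_spineBox_criticalProbI_le`. -/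
theorem not_linearLRO_criticalProbI_of_critSpine
    (hD : (∀ (ρ : ℝ) (K : ℕ), 0 < ρ → 2 ≤ K →
      (∀ n : ℕ, 1 ≤ n → ∀ x ∈ box 3 n, ∀ y ∈ box 3 n,
        ρ ≤ (bondPercolation (zdGraph 3) (criticalProbI 3)).real (openConnIn ↑(box 3 (K * n)) x y)) →
      ∀ δ : ℝ, 0 < δ →
        ∃ K' s m L : ℕ, 2 ≤ K' ∧ K' ≤ L ∧ 1 ≤ m ∧
          1 - δ < (bondPercolation (zdGraph 3) (criticalProbI 3)).real (spineBox K' s m L))) :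
    ¬ (∃ ρ : ℝ, 0 < ρ ∧ ∃ K : ℕ, ∀ n : ℕ, 1 ≤ n → ∀ x ∈ box 3 n, ∀ y ∈ box 3 n,
        ρ ≤ (bondPercolation (zdGraph 3) (criticalProbI 3)).real (openConnIn ↑(box 3 (K * n)) x y)) := by
  rintro ⟨ρ, hρ, K, hK⟩
  by_cases hK2 : 2 ≤ K
  · obtain ⟨δ₀, hδ, hle⟩ := real_spineBox_criticalProbI_le
    obtain ⟨K', s, m, L, hK', hKL, hm, hgt⟩ := hD ρ K hρ hK2 hK δ₀ hδ
    exact absurd (hle K' L hK' hKL s m hm) (not_le.2 hgt)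
  · interval_cases K
    · have h1 : (Pi.single 0 1 : Site 3) ∈ box 3 1 := by
        rw [mem_box]; intro i; by_cases hi : i = 0
        · subst hi; simp
        · simp [Pi.single_eq_of_ne hi]
      have h := hK 1 le_rfl 0 (zero_mem_box 3 1) (Pi.single 0 1) h1
      have hempty : (openConnIn (↑(box 3 (0 * 1)) : Set (Site 3)) (0 : Site 3) (Pi.single 0 1) :
          Set (BondConfig (Site 3))) = ∅ := by
        ext ω
        simp only [Set.mem_empty_iff_false, iff_false]
        rintro ⟨-, hy, -⟩
        rw [zero_mul, Finset.mem_coe, mem_box] at hy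
        have := hy 0
        simp at this
      rw [hempty, measureReal_empty] at h
      exact absurd h (not_le.2 hρ)
    · exact stub_noLRO_K1 ⟨ρ, hρ, hK⟩

/-- **The near-maximal regime with a `1/K` window, PROVED** (reshape 3): there is an ABSOLUTE constant `c₀ > 0` such that
for every `K ≥ 2`, linear-scale finite-box LRO at `p_c` with constants `(ρ, K)` is impossible once
`ρ ≥ (1 − c₀/K)·θ(p_c)²`.  Proof: `δ₀` from the spine criterion, `c₀ := δ₀/2000`; with `L := K` and
`η₀ := c₀/K`, a local scale `s` with `(1 − 2η₀)θ_s² ≤ (1 − η₀)θ² ≤ ρ` makes Stub M2 give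
`P(dense fails) ≤ 96 η₀ + 200/(θ_s² m³)`, so by Stub S3 `P(spine fails) ≤ (4K+2)(96 c₀/K + 200/(θ_s² m³)) < δ₀` for
`m` large; contradiction with `real_spineBox_criticalProbI_le`. -/
theorem not_nearMaximal_linearLRO_criticalProbI' :
    ∃ c₀ : ℝ, 0 < c₀ ∧ ∀ K : ℕ, 2 ≤ K → ∀ ρ : ℝ, 0 < ρ →
      (1 - c₀ / K) * theta (zdGraph 3) 0 (criticalProbI 3) ^ 2 ≤ ρ →
      ¬ (∀ n : ℕ, 1 ≤ n → ∀ x ∈ box 3 n, ∀ y ∈ box 3 n,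
          ρ ≤ (bondPercolation (zdGraph 3) (criticalProbI 3)).real (openConnIn ↑(box 3 (K * n)) x y)) := by
  obtain ⟨δ₀, hδ, hle⟩ := real_spineBox_criticalProbI_le
  have hδ1 : δ₀ ≤ 1 := by
    have h := hle 2 2 le_rfl le_rfl 0 1 le_rfl
    linarith [measureReal_nonneg (μ := bondPercolation (zdGraph 3) (criticalProbI 3)) (s := spineBox 2 0 1 2)]
  refine ⟨δ₀ / 2000, by positivity, ?_⟩
  intro K hK ρ hρ hnear hLRO
  set P := bondPercolation (zdGraph 3) (criticalProbI 3) with hP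
  set θ : ℝ := theta (zdGraph 3) 0 (criticalProbI 3) with hθdef
  have hθρ : ρ ≤ θ := le_theta_of_linearLRO (criticalProbI 3) hLRO
  have hθ : 0 < θ := hρ.trans_le hθρ
  have hK0 : (0 : ℝ) < K := by exact_mod_cast (lt_of_lt_of_le (by norm_num) hK : 0 < K)
  have hK2 : (2 : ℝ) ≤ K := by exact_mod_cast hK
  set η₀ : ℝ := δ₀ / 2000 / K with hη₀
  have hη₀pos : 0 < η₀ := by positivity
  have hη₀1 : η₀ < 1 / 4 := by
    rw [hη₀, div_lt_iff₀ hK0]; nlinarith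
  have hnear' : (1 - η₀) * θ ^ 2 ≤ ρ := by
    have : δ₀ / 2000 / (K : ℝ) = η₀ := rfl
    rw [← this] at *; exact hnear
  -- a local scale `s` with `(1 - 2η₀) θ_s² < (1 - η₀) θ²`
  have hlim := tendsto_real_siteToBoundary (d := 3) (criticalProbI 3)
  have htarget : (1 - 2 * η₀) * θ ^ 2 < (1 - η₀) * θ ^ 2 := by
    have h1 : (1 - η₀) * θ ^ 2 - (1 - 2 * η₀) * θ ^ 2 = η₀ * θ ^ 2 := by ring
    have h2 : 0 < η₀ * θ ^ 2 := by positivity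
    linarith
  have hlim2 : Tendsto (fun s : ℕ => (1 - 2 * η₀) * (P.real (siteToBoundary 3 s)) ^ 2) atTop
      (𝓝 ((1 - 2 * η₀) * θ ^ 2)) :=
    ((hlim.pow 2).const_mul (1 - 2 * η₀))
  obtain ⟨s, hs⟩ := (hlim2.eventually (gt_mem_nhds htarget)).exists
  set θs : ℝ := P.real (siteToBoundary 3 s) with hθs
  have hθs_ge : θ ≤ θs := DCT16.theta_le_real_siteToBoundary (criticalProbI 3) s
  have hθs_pos : 0 < θs := hθ.trans_le hθs_ge
  -- the pair-sum hypothesis of Stub M2 with η = 2η₀, at every grid size m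
  have hpairs : ∀ m : ℕ, 1 ≤ m →
      (1 - 2 * η₀) * θs ^ 2 * ((coreGrid s m).card : ℝ) ^ 2 ≤
        ∑ y ∈ coreGrid s m, ∑ y' ∈ coreGrid s m,
          P.real (openConnIn ↑(box 3 (K * ((2 * s + 1) * m))) y y') := by
    intro m hm
    have hn1 : 1 ≤ (2 * s + 1) * m := Nat.mul_pos (Nat.succ_pos _) hm
    have hterm : ∀ y ∈ coreGrid s m, ∀ y' ∈ coreGrid s m,
        (1 - 2 * η₀) * θs ^ 2 ≤ P.real (openConnIn ↑(box 3 (K * ((2 * s + 1) * m))) y y') := by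
      intro y hy y' hy'
      have h := hLRO ((2 * s + 1) * m) hn1 y (coreGrid_subset_box s m hy) y' (coreGrid_subset_box s m hy')
      linarith [hs.le]
    calc (1 - 2 * η₀) * θs ^ 2 * ((coreGrid s m).card : ℝ) ^ 2
        = ∑ _y ∈ coreGrid s m, ∑ _y' ∈ coreGrid s m, (1 - 2 * η₀) * θs ^ 2 := by
          rw [Finset.sum_const, Finset.sum_const, nsmul_eq_mul, nsmul_eq_mul]; ring
      _ ≤ _ := Finset.sum_le_sum fun y hy => Finset.sum_le_sum fun y' hy' => hterm y hy y' hy'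
  -- a grid size m with (4K+2)·200/(θs² m³) < δ₀/2
  obtain ⟨m, hm1, hm⟩ : ∃ m : ℕ, 1 ≤ m ∧ (4 * (K : ℝ) + 2) * (200 / (θs ^ 2 * (m : ℝ) ^ 3)) < δ₀ / 2 := by
    have ht : Tendsto (fun m : ℕ => (4 * (K : ℝ) + 2) * (200 / (θs ^ 2 * (m : ℝ) ^ 3))) atTop (𝓝 0) := by
      have h3 : Tendsto (fun m : ℕ => θs ^ 2 * (m : ℝ) ^ 3) atTop atTop :=
        Tendsto.const_mul_atTop (by positivity)
          ((tendsto_pow_atTop (by norm_num : (3 : ℕ) ≠ 0)).comp (tendsto_natCast_atTop_atTop (R := ℝ)))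
      have h4 : Tendsto (fun m : ℕ => (200 : ℝ) / (θs ^ 2 * (m : ℝ) ^ 3)) atTop (𝓝 0) :=
        tendsto_const_nhds.div_atTop h3
      simpa using h4.const_mul (4 * (K : ℝ) + 2)
    obtain ⟨m, hm⟩ := ((ht.eventually (gt_mem_nhds (half_pos hδ))).and (eventually_ge_atTop 1)).exists
    exact ⟨m, hm.2, hm.1⟩
  -- Stub M2 and Stub S3 at p_c
  have hMarkov := stub_denseMarkov (criticalProbI 3) K s m (2 * η₀) (by omega) hm1 hθs_pos (hpairs m hm1)
  have hSpine : P.real (spineBox K s m K)ᶜ ≤ (4 * K + 2) * P.real (denseBox K s m)ᶜ :=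
    stub_spineFailure (criticalProbI 3) K s m K
  have hK42 : (0 : ℝ) ≤ 4 * K + 2 := by positivity
  have hcompl : P.real (spineBox K s m K)ᶜ < δ₀ := by
    have h1 : P.real (spineBox K s m K)ᶜ ≤ (4 * (K : ℝ) + 2) * (48 * (2 * η₀) + 200 / (θs ^ 2 * (m : ℝ) ^ 3)) := by
      refine hSpine.trans ?_
      exact mul_le_mul_of_nonneg_left hMarkov hK42
    have h2 : (4 * (K : ℝ) + 2) * (48 * (2 * η₀)) ≤ 6 * K * (96 * η₀) := by nlinarith
    have h3 : 6 * (K : ℝ) * (96 * η₀) = 576 * (δ₀ / 2000) := by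
      rw [hη₀]; field_simp; ring
    nlinarith [h1, h2, h3, hm]
  have hmeas : MeasurableSet (spineBox K s m K) := measurableSet_spineBox hK hm1 K
  have hdense : 1 - δ₀ < P.real (spineBox K s m K) := by
    have h1 : P.real (spineBox K s m K) + P.real (spineBox K s m K)ᶜ = 1 := by
      rw [measureReal_add_measureReal_compl hmeas, probReal_univ]
    linarith
  exact absurd (hle K K hK le_rfl s m hm1) (not_le.2 hdense)

/-- **Anatomy: the spine stub is implied by the dense stub** (Stub S3 with `L := K'` and the schedule
`δ(K') := δ/(4K'+2)`), so reshape 3 only WEAKENED the open content. -/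
theorem critSpine_of_critDense
    (hD : (∀ (ρ : ℝ) (K : ℕ), 0 < ρ → 2 ≤ K →
      (∀ n : ℕ, 1 ≤ n → ∀ x ∈ box 3 n, ∀ y ∈ box 3 n,
        ρ ≤ (bondPercolation (zdGraph 3) (criticalProbI 3)).real (openConnIn ↑(box 3 (K * n)) x y)) →
      ∀ δ : ℕ → ℝ, (∀ K', 0 < δ K') →
        ∃ K' s m : ℕ, 2 ≤ K' ∧ 1 ≤ m ∧
          1 - δ K' < (bondPercolation (zdGraph 3) (criticalProbI 3)).real (denseBox K' s m))) :
    (∀ (ρ : ℝ) (K : ℕ), 0 < ρ → 2 ≤ K →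
      (∀ n : ℕ, 1 ≤ n → ∀ x ∈ box 3 n, ∀ y ∈ box 3 n,
        ρ ≤ (bondPercolation (zdGraph 3) (criticalProbI 3)).real (openConnIn ↑(box 3 (K * n)) x y)) →
      ∀ δ : ℝ, 0 < δ →
        ∃ K' s m L : ℕ, 2 ≤ K' ∧ K' ≤ L ∧ 1 ≤ m ∧
          1 - δ < (bondPercolation (zdGraph 3) (criticalProbI 3)).real (spineBox K' s m L)) := by
  intro ρ K hρ hK hLRO δ hδ
  obtain ⟨K', s, m, hK', hm, hgt⟩ := hD ρ K hρ hK hLRO (fun K' => δ / (4 * K' + 2)) (fun K' => by positivity)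
  refine ⟨K', s, m, K', hK', le_rfl, hm, ?_⟩
  set P := bondPercolation (zdGraph 3) (criticalProbI 3) with hP
  have hmeasD : MeasurableSet (denseBox K' s m) := measurableSet_denseBox hK' hm
  have hmeasS : MeasurableSet (spineBox K' s m K') := measurableSet_spineBox hK' hm K'
  have hD1 : P.real (denseBox K' s m) + P.real (denseBox K' s m)ᶜ = 1 := by
    rw [measureReal_add_measureReal_compl hmeasD, probReal_univ]
  have hS1 : P.real (spineBox K' s m K') + P.real (spineBox K' s m K')ᶜ = 1 := by
    rw [measureReal_add_measureReal_compl hmeasS, probReal_univ]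
  have hS := stub_spineFailure (criticalProbI 3) K' s m K'
  have hK0 : (0 : ℝ) < 4 * K' + 2 := by positivity
  have hDc : P.real (denseBox K' s m)ᶜ < δ / (4 * K' + 2) := by linarith
  have : (4 * (K' : ℝ) + 2) * P.real (denseBox K' s m)ᶜ < δ := by
    have := mul_lt_mul_of_pos_left hDc hK0
    rwa [mul_div_cancel₀ _ hK0.ne'] at this
  linarith

/-- **The crux from the weakened open statement of the line** (`stub_critSpine`). -/
theorem renormaliseFromLinearLRO_of_critSpine
    (hD : (∀ (ρ : ℝ) (K : ℕ), 0 < ρ → 2 ≤ K →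
      (∀ n : ℕ, 1 ≤ n → ∀ x ∈ box 3 n, ∀ y ∈ box 3 n,
        ρ ≤ (bondPercolation (zdGraph 3) (criticalProbI 3)).real (openConnIn ↑(box 3 (K * n)) x y)) →
      ∀ δ : ℝ, 0 < δ →
        ∃ K' s m L : ℕ, 2 ≤ K' ∧ K' ≤ L ∧ 1 ≤ m ∧
          1 - δ < (bondPercolation (zdGraph 3) (criticalProbI 3)).real (spineBox K' s m L))) :
    Summit.CriticalPhenomena.PercolationContinuityZ3.Theses.PercFiniteBoxLRO.RenormaliseFromLinearLRO :=
  renormaliseFromLinearLRO_of_not_linearLRO_criticalProbI (not_linearLRO_criticalProbI_of_critSpine hD)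

/-! ## Registered sub-goals of the item (closed here) -/

/-- **Registered sub-goal `stub_noSpineAtPc` of crux stmt-CriticalPhenomena-0857**: no spine blocks at criticality —
one `δ₀ > 0` with `P_{p_c(ℤ³)}(spineBox K s m L) ≤ 1 − δ₀` for all `2 ≤ K ≤ L`, `s`, `m ≥ 1`.  Unconditional. -/
theorem stub_noSpineAtPc :
    ∃ δ₀ : ℝ, 0 < δ₀ ∧ ∀ (K L : ℕ), 2 ≤ K → K ≤ L → ∀ s m : ℕ, 1 ≤ m →
      (bondPercolation (zdGraph 3) (criticalProbI 3)).real (spineBox K s m L) ≤ 1 - δ₀ :=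
  real_spineBox_criticalProbI_le

/-- **Registered sub-goal `stub_noNearMaximalLRO_inv` of crux stmt-CriticalPhenomena-0857 — the near-maximal regime with
a `1/K` window, settled**: an absolute `c₀ > 0` such that for every `K ≥ 2`, no `ρ > 0` with `(1 − c₀/K)·θ(p_c)² ≤ ρ`
satisfies `ρ ≤ P_{p_c}(x ↔ y inside Λ(Kn))` for all `n ≥ 1`, `x, y ∈ Λ(n)`.  Unconditional. -/
theorem stub_noNearMaximalLRO_inv :
    ∃ c₀ : ℝ, 0 < c₀ ∧ ∀ K : ℕ, 2 ≤ K → ∀ ρ : ℝ, 0 < ρ →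
      (1 - c₀ / K) * theta (zdGraph 3) 0 (criticalProbI 3) ^ 2 ≤ ρ →
      ¬ (∀ n : ℕ, 1 ≤ n → ∀ x ∈ box 3 n, ∀ y ∈ box 3 n,
          ρ ≤ (bondPercolation (zdGraph 3) (criticalProbI 3)).real (openConnIn ↑(box 3 (K * n)) x y)) :=
  not_nearMaximal_linearLRO_criticalProbI'

end Summit.CriticalPhenomena.PercolationContinuityZ3.Theorems.RenormaliseFromLinearLRO

end
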